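import Mathlib
import Literature.AlgebraicGeometry.Ramification.InertiaNormalSylow
import Literature.RingTheory.CompleteLocalRings.TameAutomorphismCotangent
import HarnessLib

/-!
# Inertia after blowing up a point of embedding dimension `≤ 2` is p-closed (crux `WildQuotients.WildQuotientResolution`, line `Sketch`)

Stub `stub_borelCore` of the skeleton `Sketch` for crux stmt-ResolutionOfSingularities-15640
(route `ResolutionOfSingularities/WildQuotients`): the algebraic heart of Phase 0 ("Sylow
separation") on a SURFACE. Data: a Noetherian local ring `(R, 𝔪, κ)` with `dim_κ 𝔪/𝔪² ≤ 2`, a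
local domain `(S, 𝔫, κ₁)`, both residue fields of characteristic `p`; an injective local
homomorphism `ι : R → S` with `𝔪S = ι(t)S` for some `t ∈ 𝔪` (the exceptional divisor); a finite
group `I` acting on `R` faithfully (`τ`) and on `S` residue-trivially (`τ₁`), compatibly.
Conclusion: `I` has a normal Sylow `p`-subgroup.

Proof (fixed-line argument, with elements). (1) The cotangent kernel `K := {g | (g - 1)𝔪 ⊆ 𝔪²}`
consists of elements of `p`-power order (`exists_pow_eq_one_of_cotangentTrivial`: the
prime-to-`p` part is a tame automorphism trivial on `gr⁰ ⊕ gr¹`, hence trivial by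
`Literature.RingTheory.CompleteLocalRings.ringEquiv_eq_one_of_cotangentTrivial_of_isUnit_orderOf`).
(2) For `r ∈ 𝔪` write `ι r = e_r · u`, `u = ι t ≠ 0`; `χ g := e_{g t} mod 𝔫` is a character
`I → κ₁ˣ`. (3) `r ↦ e_r mod 𝔫` kills `𝔪²`, is `κ`-semilinear, `χ`-equivariant and sends `t` to
`1`; its kernel `W ⊊ 𝔪/𝔪²` has dimension `≤ 1`, spanned by the class of some `w₀`. (4) `μ g :=`
the scalar of `g` on the line `W` (`μ = 1` if `W = 0`), a character `I → κˣ`. For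
`g ∈ U := ker (χ, μ)` and `r ∈ 𝔪`: `s := g r - r` has `e_s ∈ 𝔫` and `g s - s ∈ 𝔪²`, so
`gⁿ r ≡ r + n s (mod 𝔪²)` (`pow_apply_sub_sub_nsmul_mem`) and `g^p ∈ K`: `U` is a
`p`-group. (5) `I/U ↪ κ₁ˣ × κˣ` has no element of order `p`, so `p ∤ [I : U]`
(`HasNormalSylow.of_normal_of_not_dvd_index`). If `t = 0` then `𝔪 = 0` and `I = K`.
-/

-- single-problem summit: the doubled namespace component `ResolutionOfSingularities` is forced
set_option linter.dupNamespace false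

namespace Summit.ResolutionOfSingularities.ResolutionOfSingularities.Theorems.WildQuotientResolution.BorelCore

open IsLocalRing Literature.AlgebraicGeometry.Ramification
open Literature.RingTheory.CompleteLocalRings

/-! ## Units of order `p` in characteristic `p` -/

/-- In a field of characteristic `p`, a unit `a` with `a ^ p = 1` equals `1`:
`(a - 1) ^ p = a ^ p - 1 = 0`. [folklore] -/
theorem units_eq_one_of_pow_char_eq_one {F : Type*} [Field F] (p : ℕ) [Fact p.Prime] [CharP F p]
    {a : Fˣ} (h : a ^ p = 1) : a = 1 := by
  apply Units.ext
  have h' : (a : F) ^ p = 1 := by rw [← Units.val_pow_eq_pow_val, h, Units.val_one]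
  have hsub := sub_pow_char (a : F) 1 (p := p)
  rw [h', one_pow, sub_self] at hsub
  rw [Units.val_one]
  exact sub_eq_zero.mp ((pow_eq_zero_iff (Fact.out : p.Prime).ne_zero).mp hsub)

/-! ## Automorphisms of a local ring and the cotangent kernel -/

section LocalRing

variable {R : Type*} [CommRing R] [IsLocalRing R]

/-- A ring automorphism of a local ring maps the maximal ideal into itself. [folklore] -/
theorem ringAut_apply_mem_maximalIdeal (φ : R ≃+* R) {r : R} (hr : r ∈ maximalIdeal R) :
    φ r ∈ maximalIdeal R := by
  have h := map_maximalIdeal_pow_le φ 1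
  rw [pow_one] at h
  exact h (Ideal.mem_map_of_mem _ hr)

/-- A ring automorphism of a local ring maps every power of the maximal ideal into itself.
[folklore] -/
theorem ringAut_apply_mem_maximalIdeal_pow (φ : R ≃+* R) (n : ℕ) {r : R}
    (hr : r ∈ maximalIdeal R ^ n) : φ r ∈ maximalIdeal R ^ n :=
  map_maximalIdeal_pow_le φ n (Ideal.mem_map_of_mem _ hr)

/-- **Iterates of a unipotent automorphism on the cotangent space**: if `φ (φ r - r) - (φ r - r)`
lies in `𝔪²` then `φⁿ r - r - n • (φ r - r) ∈ 𝔪²` for all `n` (binomial expansion of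
`(1 + N)ⁿ` with `N² ≡ 0`). [folklore] -/
theorem pow_apply_sub_sub_nsmul_mem (φ : R ≃+* R) {r : R}
    (h2 : φ (φ r - r) - (φ r - r) ∈ maximalIdeal R ^ 2) (n : ℕ) :
    (φ ^ n) r - r - n • (φ r - r) ∈ maximalIdeal R ^ 2 := by
  induction n with
  | zero => rw [pow_zero, RingAut.one_apply, zero_nsmul, sub_zero, sub_self]; exact zero_mem _
  | succ n ih =>
    have key : (φ ^ (n + 1)) r - r - (n + 1) • (φ r - r) =
        φ ((φ ^ n) r - r - n • (φ r - r)) + n • (φ (φ r - r) - (φ r - r)) := by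
      rw [pow_succ', RingAut.mul_apply]
      simp only [map_sub, map_nsmul]; simp only [nsmul_eq_mul]; push_cast; ring
    rw [key]
    exact add_mem (ringAut_apply_mem_maximalIdeal_pow φ 2 ih) (nsmul_mem h2 n)

variable {I : Type*} [Group I]

/-- The elements of `I` acting trivially on the cotangent space `𝔪/𝔪²` of the local ring `R`
(`∀ r ∈ 𝔪, τ g r - r ∈ 𝔪²`, the "cotangent kernel") are closed under multiplication. [folklore] -/
theorem cotangentTrivial_mul (τ : I →* (R ≃+* R)) {a b : I}
    (ha : ∀ r ∈ maximalIdeal R, τ a r - r ∈ maximalIdeal R ^ 2)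
    (hb : ∀ r ∈ maximalIdeal R, τ b r - r ∈ maximalIdeal R ^ 2) :
    ∀ r ∈ maximalIdeal R, τ (a * b) r - r ∈ maximalIdeal R ^ 2 := fun r hr => by
  have e : τ (a * b) r - r = (τ a (τ b r) - τ b r) + (τ b r - r) := by
    rw [map_mul, RingAut.mul_apply]; ring
  rw [e]
  exact add_mem (ha _ (ringAut_apply_mem_maximalIdeal (τ b) hr)) (hb r hr)

/-- Powers of a cotangent-trivial element are cotangent-trivial. [folklore] -/
theorem cotangentTrivial_pow (τ : I →* (R ≃+* R)) {g : I}
    (hg : ∀ r ∈ maximalIdeal R, τ g r - r ∈ maximalIdeal R ^ 2) (n : ℕ) :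
    ∀ r ∈ maximalIdeal R, τ (g ^ n) r - r ∈ maximalIdeal R ^ 2 := by
  induction n with
  | zero => intro r _; rw [pow_zero, map_one, RingAut.one_apply, sub_self]; exact zero_mem _
  | succ n ih => rw [pow_succ g n]; exact cotangentTrivial_mul τ ih hg

/-- **The cotangent kernel is a `p`-group** (residue characteristic `p`, `R` Noetherian, faithful
residue-trivial action `τ`): an element `g` acting trivially on `𝔪/𝔪²` has `p`-power order. Write
`ord g = pᵃ m` with `p ∤ m`; `h := g ^ pᵃ` has order `m`, a unit of `R`, and acts trivially on the
residue field and on `𝔪/𝔪²`, so `τ h = 1` by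
`Literature.RingTheory.CompleteLocalRings.ringEquiv_eq_one_of_cotangentTrivial_of_isUnit_orderOf`,
hence `h = 1`. [folklore] -/
theorem exists_pow_eq_one_of_cotangentTrivial (p : ℕ) [Fact p.Prime] [IsNoetherianRing R]
    [CharP (ResidueField R) p] [Finite I] {τ : I →* (R ≃+* R)} (hτ : Function.Injective τ)
    (hres : ∀ (g : I) (r : R), τ g r - r ∈ maximalIdeal R) {g : I}
    (hg : ∀ r ∈ maximalIdeal R, τ g r - r ∈ maximalIdeal R ^ 2) : ∃ k : ℕ, g ^ p ^ k = 1 := by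
  obtain ⟨a, m, hpm, hord⟩ :=
    Nat.exists_eq_pow_mul_and_not_dvd (orderOf_pos g).ne' p (Fact.out : p.Prime).ne_one
  refine ⟨a, ?_⟩
  set h : I := g ^ p ^ a with hhdef
  have hp0 : p ^ a ≠ 0 := pow_ne_zero a (Fact.out : p.Prime).ne_zero
  have hordh : orderOf h = m := by
    rw [hhdef, orderOf_pow' g hp0, hord, Nat.gcd_mul_right_left,
      Nat.mul_div_cancel_left m (Nat.pos_of_ne_zero hp0)]
  have hh := cotangentTrivial_pow τ hg (p ^ a)
  have hunit : IsUnit ((orderOf (τ h) : ℕ) : R) := by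
    rw [orderOf_injective τ hτ h, hordh, ← residue_ne_zero_iff_isUnit, map_natCast, Ne,
      CharP.cast_eq_zero_iff (ResidueField R) p m]
    exact hpm
  have hpos : 0 < orderOf (τ h) := by rw [orderOf_injective τ hτ h]; exact orderOf_pos h
  have h1 : τ h = 1 :=
    ringEquiv_eq_one_of_cotangentTrivial_of_isUnit_orderOf (τ h) (hres h) hh hunit hpos
  exact hτ (by rw [h1, map_one])

end LocalRing

/-! ## The theorem -/

/-- **Inertia after blowing up a point of embedding dimension `≤ 2` is p-closed** (stub
`stub_borelCore` of line `Sketch`, crux stmt-ResolutionOfSingularities-15640). Let `(R, 𝔪, κ)`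
be a Noetherian local ring with `dim_κ 𝔪/𝔪² ≤ 2` and `(S, 𝔫, κ₁)` a local domain, both residue
fields of characteristic `p`; `ι : R → S` an injective local homomorphism with `𝔪S = (ι t)` for
some `t ∈ 𝔪`; `I` a finite group acting on `R` faithfully by `τ` and on `S` by `τ₁`, compatibly
(`ι ∘ τ g = τ₁ g ∘ ι`) and residue-trivially on `S`. Then `I` has a normal Sylow `p`-subgroup:
the kernel of `(χ, μ) : I → κ₁ˣ × κˣ` (`χ` = action on `ū ∈ 𝔪S/𝔫𝔪S`, `μ` = action on the line
`ker (𝔪/𝔪² → κ₁)`) is a normal `p`-subgroup of index prime to `p`. (Serre, *Corps locaux* IV §2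
Cor. 4 — the tree's `hasNormalSylow_of_faithful_residueTrivial_action` — is the discrete
valuation ring shape `R = S`.) [folklore] -/
theorem stub_borelCore (p : ℕ) [Fact p.Prime]
    {R S : Type*} [CommRing R] [IsLocalRing R] [IsNoetherianRing R]
    [CommRing S] [IsLocalRing S] [IsDomain S]
    [CharP (ResidueField R) p] [CharP (ResidueField S) p]
    (ι : R →+* S) [IsLocalHom ι] (hι : Function.Injective ι)
    (t : R) (ht : t ∈ maximalIdeal R)
    (hgen : Ideal.map ι (maximalIdeal R) = Ideal.span {ι t})
    (hdim : Module.finrank (ResidueField R) (CotangentSpace R) ≤ 2)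
    {I : Type*} [Group I] [Finite I] (τ : I →* (R ≃+* R)) (τ₁ : I →* (S ≃+* S))
    (hτ : Function.Injective τ) (hcomp : ∀ (g : I) (r : R), ι (τ g r) = τ₁ g (ι r))
    (hres : ∀ (g : I) (s : S), τ₁ g s - s ∈ maximalIdeal S) :
    HasNormalSylow p I := by
  classical
  have hp : p.Prime := Fact.out
  -- (0) `τ` is residue-trivial on `R`: `ι (τ g r - r) ∈ 𝔫` and `ι` is local
  have hresR : ∀ (g : I) (r : R), τ g r - r ∈ maximalIdeal R := fun g r => by
    have h : ι (τ g r - r) ∈ maximalIdeal S := by rw [map_sub, hcomp]; exact hres g (ι r)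
    rw [mem_maximalIdeal, mem_nonunits_iff] at h ⊢
    exact fun hu => h (hu.map ι)
  have hmm : ∀ x ∈ maximalIdeal R, ∀ y ∈ maximalIdeal R, x * y ∈ maximalIdeal R ^ 2 :=
    fun x hx y hy => by rw [pow_two]; exact Ideal.mul_mem_mul hx hy
  have hp_mem : (p : R) ∈ maximalIdeal R := by
    rw [← residue_eq_zero_iff, map_natCast, CharP.cast_eq_zero]
  -- the degenerate case `t = 0`: `𝔪 = 0`, every element is cotangent-trivial
  by_cases ht0 : t = 0
  · refine HasNormalSylow.of_isPGroup fun g => ?_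
    refine exists_pow_eq_one_of_cotangentTrivial p hτ hresR fun r hr => ?_
    have h : ι r ∈ Ideal.span {ι t} := hgen ▸ Ideal.mem_map_of_mem ι hr
    obtain ⟨a, ha⟩ := Ideal.mem_span_singleton'.mp h
    rw [ht0, map_zero, mul_zero] at ha
    have hr0 : r = 0 := hι (by rw [map_zero]; exact ha.symm)
    rw [hr0, map_zero, sub_self]; exact zero_mem _
  -- `u := ι t ≠ 0`, a non-unit of the domain `S`
  set u : S := ι t
  have hu0 : u ≠ 0 := fun h => ht0 (hι (by rw [map_zero]; exact h))
  have hu_mem : u ∈ maximalIdeal S := map_nonunit ι t ht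
  -- (2) `e r` with `ι r = e r * u` for `r ∈ 𝔪` (unique since `S` is a domain)
  have hex : ∀ r : R, ∃ a : S, r ∈ maximalIdeal R → a * u = ι r := by
    intro r
    by_cases hr : r ∈ maximalIdeal R
    · have h : ι r ∈ Ideal.span {u} := hgen ▸ Ideal.mem_map_of_mem ι hr
      obtain ⟨a, ha⟩ := Ideal.mem_span_singleton'.mp h
      exact ⟨a, fun _ => ha⟩
    · exact ⟨0, fun h => absurd h hr⟩
  choose e he using hex
  have he_uniq : ∀ r ∈ maximalIdeal R, ∀ a : S, a * u = ι r → e r = a := fun r hr a ha =>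
    mul_right_cancel₀ hu0 ((he r hr).trans ha.symm)
  have he_t : e t = 1 := he_uniq t ht 1 (one_mul u)
  have he_zero : e 0 = 0 := he_uniq 0 (zero_mem _) 0 (by rw [zero_mul, map_zero])
  have he_add : ∀ r ∈ maximalIdeal R, ∀ r' ∈ maximalIdeal R, e (r + r') = e r + e r' :=
    fun r hr r' hr' => he_uniq _ (add_mem hr hr') _ (by rw [add_mul, he r hr, he r' hr', map_add])
  have he_sub : ∀ r ∈ maximalIdeal R, ∀ r' ∈ maximalIdeal R, e (r - r') = e r - e r' :=
    fun r hr r' hr' => he_uniq _ (sub_mem hr hr') _ (by rw [sub_mul, he r hr, he r' hr', map_sub])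
  have he_smul : ∀ (a : R), ∀ r ∈ maximalIdeal R, e (a * r) = ι a * e r :=
    fun a r hr => he_uniq _ (Ideal.mul_mem_left _ a hr) _ (by rw [mul_assoc, he r hr, map_mul])
  have he_mul : ∀ r ∈ maximalIdeal R, ∀ r' ∈ maximalIdeal R, e (r * r') = e r * e r' * u :=
    fun r hr r' hr' => he_uniq _ (Ideal.mul_mem_left _ r hr') _ (by
      rw [map_mul, ← he r hr, ← he r' hr']; ring)
  -- `e` sends `𝔪²` into `𝔫`
  have he_sq : ∀ x ∈ maximalIdeal R ^ 2, x ∈ maximalIdeal R ∧ e x ∈ maximalIdeal S := by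
    intro x hx
    rw [pow_two] at hx
    refine Submodule.mul_induction_on hx (fun r hr r' hr' => ⟨Ideal.mul_mem_left _ r hr', ?_⟩)
      (fun x y hx hy => ⟨add_mem hx.1 hy.1, ?_⟩)
    · rw [he_mul r hr r' hr']; exact Ideal.mul_mem_left _ _ hu_mem
    · rw [he_add x hx.1 y hy.1]; exact add_mem hx.2 hy.2
  -- residue form of the residue-triviality of `τ₁`
  have hres' : ∀ (g : I) (s : S), residue S (τ₁ g s) = residue S s := fun g s => by
    rw [← sub_eq_zero, ← map_sub, residue_eq_zero_iff]; exact hres g s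
  have hτt : ∀ g : I, τ g t ∈ maximalIdeal R := fun g => ringAut_apply_mem_maximalIdeal (τ g) ht
  -- `c g := e (τ g t)`: `τ₁ g u = c g * u`, a unit, and the character `χ g := c g mod 𝔫`
  obtain ⟨c, hc⟩ : ∃ c : I → S, ∀ g, c g = e (τ g t) := ⟨_, fun _ => rfl⟩
  have hcu : ∀ g, c g * u = τ₁ g u := fun g => by rw [hc, he _ (hτt g), hcomp]
  have he_τ : ∀ (g : I), ∀ r ∈ maximalIdeal R, e (τ g r) = τ₁ g (e r) * c g := fun g r hr =>
    he_uniq _ (ringAut_apply_mem_maximalIdeal (τ g) hr) _ (by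
      rw [mul_assoc, hcu, ← map_mul, he r hr, hcomp])
  have hc_mul : ∀ g h : I, c (g * h) = τ₁ g (c h) * c g := fun g h => by
    rw [hc (g * h), map_mul, RingAut.mul_apply, he_τ g _ (hτt h), ← hc h]
  have hc_one : c 1 = 1 := by rw [hc, map_one, RingAut.one_apply, he_t]
  have hc_unit : ∀ g, IsUnit (c g) := fun g =>
    IsUnit.of_mul_eq_one_right (τ₁ g (c g⁻¹)) (by rw [← hc_mul, mul_inv_cancel, hc_one])
  have hc_res : ∀ g, residue S (c g) ≠ 0 := fun g =>
    (residue_ne_zero_iff_isUnit _).mpr (hc_unit g)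
  obtain ⟨χ, hχ⟩ : ∃ χ : I →* (ResidueField S)ˣ, ∀ g, (χ g : ResidueField S) = residue S (c g) :=
    ⟨{ toFun := fun g => Units.mk0 (residue S (c g)) (hc_res g)
       map_one' := Units.ext (by simp only [Units.val_mk0, hc_one, map_one, Units.val_one])
       map_mul' := fun g h => Units.ext (by
         simp only [Units.val_mk0, Units.val_mul, hc_mul, map_mul, hres']
         rw [mul_comm]) }, fun g => rfl⟩
  -- (3) `W̃ := {r ∈ 𝔪 | e r ∈ 𝔫}` is `τ`-stable and receives `τ g r - r` for `g ∈ ker χ`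
  have hW_τ : ∀ (g : I) (r : R), r ∈ maximalIdeal R → e r ∈ maximalIdeal S →
      e (τ g r) ∈ maximalIdeal S := fun g r hr her => by
    rw [he_τ g r hr]; exact Ideal.mul_mem_right _ _ (ringAut_apply_mem_maximalIdeal (τ₁ g) her)
  have hW_χ : ∀ g : I, χ g = 1 → ∀ r ∈ maximalIdeal R, e (τ g r - r) ∈ maximalIdeal S := by
    intro g hg r hr
    have hg' : residue S (c g) = 1 := by rw [← hχ, hg, Units.val_one]
    rw [← residue_eq_zero_iff, he_sub _ (ringAut_apply_mem_maximalIdeal (τ g) hr) _ hr,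
      he_τ g r hr, map_sub, map_mul, hres', hg', mul_one, sub_self]
  -- the image `W` of `W̃` in `V = 𝔪/𝔪²` is a proper subspace (`t̄ ∉ W`), hence a line or `0`
  obtain ⟨w₀, hw₀, hew₀, hgenW⟩ : ∃ w₀ : R, w₀ ∈ maximalIdeal R ∧ e w₀ ∈ maximalIdeal S ∧
      ∀ r ∈ maximalIdeal R, e r ∈ maximalIdeal S →
        ∃ a : R, r - a * w₀ ∈ maximalIdeal R ^ 2 := by
    let W : Submodule (ResidueField R) (CotangentSpace R) :=
      { carrier := {v | ∃ r : ↥(maximalIdeal R), e r ∈ maximalIdeal S ∧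
            (maximalIdeal R).toCotangent r = v}
        add_mem' := fun {v v'} hv hv' => by
          obtain ⟨r, hr, rfl⟩ := hv
          obtain ⟨r', hr', rfl⟩ := hv'
          refine ⟨r + r', ?_, map_add _ _ _⟩
          rw [Submodule.coe_add, he_add _ r.2 _ r'.2]
          exact add_mem hr hr'
        zero_mem' := ⟨0, by rw [Submodule.coe_zero, he_zero]; exact zero_mem _, map_zero _⟩
        smul_mem' := fun k {v} hv => by
          obtain ⟨r, hr, rfl⟩ := hv
          obtain ⟨a, rfl⟩ := residue_surjective k
          refine ⟨a • r, ?_, ?_⟩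
          · rw [Submodule.coe_smul, smul_eq_mul, he_smul a _ r.2]
            exact Ideal.mul_mem_left _ _ hr
          · rw [map_smul]
            rfl }
    have htW : (maximalIdeal R).toCotangent ⟨t, ht⟩ ∉ W := by
      rintro ⟨r, hr, hrt⟩
      rw [Ideal.toCotangent_eq] at hrt; change (r : R) - t ∈ maximalIdeal R ^ 2 at hrt
      have h1 := (he_sq _ hrt).2
      rw [he_sub _ r.2 _ ht, he_t] at h1
      refine (maximalIdeal.isMaximal S).ne_top ((Ideal.eq_top_iff_one _).mpr ?_)
      simpa using sub_mem hr h1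
    have hW_ne : W ≠ ⊤ := fun h => htW (h ▸ Submodule.mem_top)
    have hfin : Module.finrank (ResidueField R) W ≤ 1 := by
      have := Submodule.finrank_lt hW_ne; omega
    haveI : W.IsPrincipal := (Submodule.finrank_le_one_iff_isPrincipal W).mp hfin
    obtain ⟨v₀, hv₀⟩ := Submodule.IsPrincipal.principal W
    have hv₀W : v₀ ∈ W := by rw [hv₀]; exact Submodule.mem_span_singleton_self v₀
    obtain ⟨w₀, hw₀, hw₀v⟩ := hv₀W
    refine ⟨w₀, w₀.2, hw₀, fun r hr her => ?_⟩
    have hrW : (maximalIdeal R).toCotangent ⟨r, hr⟩ ∈ W := ⟨⟨r, hr⟩, her, rfl⟩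
    rw [hv₀, Submodule.mem_span_singleton] at hrW
    obtain ⟨k, hk⟩ := hrW
    obtain ⟨a, rfl⟩ := residue_surjective k
    refine ⟨a, ?_⟩
    rw [← hw₀v] at hk
    have h : (maximalIdeal R).toCotangent ⟨r, hr⟩ = (maximalIdeal R).toCotangent (a • w₀) := by
      rw [← hk, map_smul]; rfl
    rw [Ideal.toCotangent_eq] at h
    simpa using h
  -- (4) the second character `μ : I →* κˣ`, the action on the line `W`
  obtain ⟨μ, hμ⟩ : ∃ μ : I →* (ResidueField R)ˣ, ∀ g, μ g = 1 →
      ∀ r ∈ maximalIdeal R, e r ∈ maximalIdeal S → τ g r - r ∈ maximalIdeal R ^ 2 := by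
    by_cases hw2 : w₀ ∈ maximalIdeal R ^ 2
    · -- `W = 0`: `W̃ ⊆ 𝔪²`, take `μ = 1`
      refine ⟨1, fun g _ r hr her => ?_⟩
      obtain ⟨a, ha⟩ := hgenW r hr her
      have hr2 : r ∈ maximalIdeal R ^ 2 := by simpa using add_mem ha (Ideal.mul_mem_left _ a hw2)
      exact sub_mem (ringAut_apply_mem_maximalIdeal_pow (τ g) 2 hr2) hr2
    · -- `W = κ w̄₀` with `w̄₀ ≠ 0`: `τ g w₀ ≡ m g · w₀ (mod 𝔪²)`
      choose m hm using fun g : I =>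
        hgenW (τ g w₀) (ringAut_apply_mem_maximalIdeal (τ g) hw₀) (hW_τ g w₀ hw₀ hew₀)
      have hm_uniq : ∀ (g : I) (a : R), τ g w₀ - a * w₀ ∈ maximalIdeal R ^ 2 →
          residue R a = residue R (m g) := by
        intro g a ha
        rw [← sub_eq_zero, ← map_sub, residue_eq_zero_iff]
        by_contra hnot
        have hunit : IsUnit (a - m g) := by
          rwa [mem_maximalIdeal, mem_nonunits_iff, not_not] at hnot
        apply hw2
        have h1 : (a - m g) * w₀ ∈ maximalIdeal R ^ 2 := by
          convert sub_mem (hm g) ha using 1; ring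
        obtain ⟨v, hv⟩ := hunit.exists_left_inv
        have h2 := Ideal.mul_mem_left _ v h1
        rwa [← mul_assoc, hv, one_mul] at h2
      have hm_ne : ∀ g, residue R (m g) ≠ 0 := by
        intro g h0
        rw [residue_eq_zero_iff] at h0
        apply hw2
        have h1 : τ g w₀ ∈ maximalIdeal R ^ 2 := by simpa using add_mem (hm g) (hmm _ h0 _ hw₀)
        have h2 := ringAut_apply_mem_maximalIdeal_pow (τ g⁻¹) 2 h1
        rwa [← RingAut.mul_apply, ← map_mul, inv_mul_cancel, map_one, RingAut.one_apply] at h2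
      have hm_one : residue R (m 1) = 1 := by
        rw [← hm_uniq 1 1 (by rw [map_one, RingAut.one_apply, one_mul, sub_self]; exact zero_mem _),
          map_one]
      have hm_mul : ∀ g h, residue R (m (g * h)) = residue R (m g) * residue R (m h) := by
        intro g h
        rw [← map_mul]
        refine (hm_uniq (g * h) (m g * m h) ?_).symm
        have key : τ (g * h) w₀ - m g * m h * w₀ =
            τ g (τ h w₀ - m h * w₀) + (τ g (m h) - m h) * τ g w₀ + m h * (τ g w₀ - m g * w₀) := by
          rw [map_mul, RingAut.mul_apply, map_sub, map_mul]; ring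
        rw [key]
        refine add_mem (add_mem ?_ ?_) ?_
        · exact ringAut_apply_mem_maximalIdeal_pow (τ g) 2 (hm h)
        · exact hmm _ (hresR g (m h)) _ (ringAut_apply_mem_maximalIdeal (τ g) hw₀)
        · exact Ideal.mul_mem_left _ _ (hm g)
      obtain ⟨μ, hμv⟩ :
          ∃ μ : I →* (ResidueField R)ˣ, ∀ g, (μ g : ResidueField R) = residue R (m g) :=
        ⟨{ toFun := fun g => Units.mk0 (residue R (m g)) (hm_ne g)
           map_one' := Units.ext (by simp only [Units.val_mk0, hm_one, Units.val_one])
           map_mul' := fun g h => Units.ext (by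
             simp only [Units.val_mk0, Units.val_mul, hm_mul]) }, fun g => rfl⟩
      refine ⟨μ, fun g hg r hr her => ?_⟩
      have hg1 : residue R (m g) = 1 := by rw [← hμv, hg, Units.val_one]
      have hmg : m g - 1 ∈ maximalIdeal R := by
        rw [← residue_eq_zero_iff, map_sub, map_one, hg1, sub_self]
      obtain ⟨a, ha⟩ := hgenW r hr her
      have key : τ g r - r = (τ g (r - a * w₀) - (r - a * w₀)) + (τ g a - a) * τ g w₀ +
          a * (τ g w₀ - m g * w₀) + a * ((m g - 1) * w₀) := by
        rw [map_sub, map_mul]; ring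
      rw [key]
      refine add_mem (add_mem (add_mem ?_ ?_) ?_) ?_
      · exact sub_mem (ringAut_apply_mem_maximalIdeal_pow (τ g) 2 ha) ha
      · exact hmm _ (hresR g a) _ (ringAut_apply_mem_maximalIdeal (τ g) hw₀)
      · exact Ideal.mul_mem_left _ _ (hm g)
      · exact Ideal.mul_mem_left _ _ (hmm _ hmg _ hw₀)
  -- (5) `U := ker (χ, μ)` is a normal `p`-subgroup …
  let f : I →* (ResidueField S)ˣ × (ResidueField R)ˣ := χ.prod μ
  have hU : IsPGroup p f.ker := by
    rintro ⟨g, hg⟩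
    have hg' := hg
    rw [MonoidHom.mem_ker, MonoidHom.prod_apply, Prod.mk_eq_one] at hg'
    have hgp : ∀ r ∈ maximalIdeal R, τ (g ^ p) r - r ∈ maximalIdeal R ^ 2 := by
      intro r hr
      have hs : τ g r - r ∈ maximalIdeal R := hresR g r
      have h2 : τ g (τ g r - r) - (τ g r - r) ∈ maximalIdeal R ^ 2 :=
        hμ g hg'.2 _ hs (hW_χ g hg'.1 r hr)
      have h3 := pow_apply_sub_sub_nsmul_mem (τ g) h2 p
      have h4 : p • (τ g r - r) ∈ maximalIdeal R ^ 2 := by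
        rw [nsmul_eq_mul]; exact hmm _ hp_mem _ hs
      have h5 := add_mem h3 h4
      rwa [sub_add_cancel, ← map_pow] at h5
    obtain ⟨k, hk⟩ := exists_pow_eq_one_of_cotangentTrivial p hτ hresR hgp
    refine ⟨k + 1, Subtype.ext ?_⟩
    rw [Subgroup.coe_pow, Subgroup.coe_one, pow_succ', pow_mul]
    exact hk
  -- … of index prime to `p`: `I/U ↪ κ₁ˣ × κˣ` has no element of order `p`
  have hindex : ¬p ∣ f.ker.index := by
    intro hdvd
    rw [Subgroup.index_eq_card] at hdvd
    obtain ⟨x, hx⟩ := exists_prime_orderOf_dvd_card' (G := I ⧸ f.ker) p hdvd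
    have hyp : QuotientGroup.kerLift f x ^ p = 1 := by
      rw [← map_pow, ← hx, pow_orderOf_eq_one, map_one]
    have hy1 : QuotientGroup.kerLift f x = 1 :=
      Prod.ext
        (units_eq_one_of_pow_char_eq_one p (by have h := congrArg Prod.fst hyp; simpa using h))
        (units_eq_one_of_pow_char_eq_one p (by have h := congrArg Prod.snd hyp; simpa using h))
    have hx1 : x = 1 := QuotientGroup.kerLift_injective f (by rw [hy1, map_one])
    rw [hx1, orderOf_one] at hx
    exact hp.one_lt.ne hx
  exact HasNormalSylow.of_normal_of_not_dvd_index f.ker hU hindex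

end Summit.ResolutionOfSingularities.ResolutionOfSingularities.Theorems.WildQuotientResolution.BorelCore
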